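import Summits.NavierStokesRegularity.FunctionalMining.ThreeWaveWitness
import Summits.NavierStokesRegularity.FunctionalMining.PalinstrophyRefutation
import Summits.NavierStokesRegularity.FunctionalMining.NoGo.PalinstrophySupRateRefutation
import Summits.NavierStokesRegularity.FunctionalMining.PalinstrophyLogWindow
import Summits.NavierStokesRegularity.FunctionalMining.PalinstrophyLogDoorLargeC
import Summits.NavierStokesRegularity.FunctionalMining.PalinstrophyLadderProofs
import Summits.NavierStokesRegularity.FunctionalMining.StretchingHolderBound
import HarnessLib

/-!
# Functional mining — the no-go barrier `B0` as ONE kernel statement (ledger v6, instruction (iv))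

Search for candidate a priori estimates; no regularity claim.

NS FUNCTIONAL MINING cell (`pub-nsfunc`), no-go seat, `NOGO.md` §1/§4/§6. This file asserts nothing
new: it is the CONJUNCTION of the tree's kernel-checked rows of the no-go table, so that the barrier of
`NOGO.md` can be cited by a single declaration, with its scope exactly as typed (unit torus `(ℝ/ℤ)³`,
zero-mean classical solutions of unforced Navier–Stokes, every `ν` in the range each row states).

NEGATIVE ROWS (`barrier_negative_rows`, all REFUTED in the kernel):
* T1  `ℰ` is not monotone (`G ≡ 0`): `not_isRateBudget_torusEnstrophy_zero` (three-wave field);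
* T2  `dℰ/dt ≤ Cℰ²/ν` fails for every `C` (row C1): `not_enstrophyQuadraticBudget`;
* T3  every monomial budget `C(ν) K^a ℰ^b D^e` with `b − a + 3e < 3` fails for `ℰ`:
      `not_isRateBudget_torusEnstrophy_monomial`;
* T4  `𝒫' = ½‖Δu‖²` is not monotone: `not_isRateBudget_palinstrophy_zero`;
* T5  every monomial budget with `b − a + 3e < 5` fails for `𝒫'`: `not_isRateBudget_palinstrophy_monomial`;
* N6  `d𝒫/dt ≤ C‖ω‖_∞𝒫` fails for every `C`, static and dynamic rows:
      `LogDoor.palinstrophySupRateFails_fin3`, `palinstrophyRateSupFails_fin3`;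
* T10 the logged row `PalinstrophyLogBudget C c` fails for `C ≤ 1/40`, `0 ≤ c ≤ 1` (certificate W12):
      `not_palinstrophyLogBudget_of_le`.

POSITIVE ROWS (`barrier_positive_rows`, all PROVED in the kernel — the typed escape doors that are
known to be open):
* D-log  the logged row holds for LARGE `C` (`PalinstrophyLogBudgetLargeC`, BKM shape):
         `palinstrophyLogBudgetLargeC_fin3_holds`; hence `1/40 ≤ C₀(c)` and the valid set is the ray
         `[C₀(c), ∞)` for `0 < c ≤ 1` (`oneFortieth_le_logBudgetThreshold`);
* D-sat  the palinstrophy SATURATING law `d𝒫/dt ≤ κ ν^{-5/3}(2ℰ)𝒫^{4/3}`, `κ ≥ κ_A`: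
         `palinstrophyLadderLaw` (the strain-currency improvement `κ ≥ (2/3)^{4/3}κ_A` is staged,
         `NoGo/PalinstrophyStrainTransport`);
* D-Höl  enstrophy production `≤ (2/√3)‖ω‖_∞ ℰ` (Hölder constant; the supremum constant `1` is NOT
         sharp — `¬ StretchingSupSharp`, staged `NoGo/StretchingSupNotSharp`):
         `stretchingSupHolder_holds`, `enstrophyRateSupBound_holder`.

OPEN typed edges (NOT asserted here; listed for the record): `PalinstrophyLogThreshold`
(`C₀(c) ≥ 2/π`, paper-level N9; the kernel has `∃ C₀ > 0` uniformly in `c`, prove seat, landing),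
the window conjecture `⨅_c C₀(c) = 2/π`, and K1-Q2 at `q = 2m ≥ 4`
(`MiddleEigenvalueMomentRateBound (2m) C`: kill-all witness existence, NOGO N11).

Honest framing: a bookkeeping conjunction of results proved elsewhere in this directory
[ours — internal, unreviewed beyond the kernel]; nothing about Navier–Stokes regularity is claimed or
implied.
-/

noncomputable section

open MeasureTheory

namespace Summit.NavierStokesRegularity.FunctionalMining

open Literature.Analysis Literature.Analysis.FunctionSpaces Literature.Analysis.FluidPDE

/-- **Barrier B0, negative rows (ledger v6)** — every displayed budget class is REFUTED along
zero-mean classical Navier–Stokes solutions on the unit 3-torus (rows T1–T5, N6 static + dynamic,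
T10), as the conjunction of the tree theorems named in the module docstring. Search for candidate
a priori estimates; no regularity claim. [ours] -/
theorem barrier_negative_rows :
    (¬ IsRateBudget (d := Fin 3) torusEnstrophy (fun _ _ => 0)) ∧
    (∀ C : ℝ, ¬ EnstrophyQuadraticBudget (d := Fin 3) C) ∧
    (∀ a b e : ℝ, b - a + 3 * e < 3 → ∀ Cν : ℝ → ℝ,
      ¬ IsRateBudget (d := Fin 3) torusEnstrophy (fun ν v =>
        Cν ν * Torus.kineticEnergy v ^ a * torusEnstrophy v ^ b *
          (∫ x, ‖Torus.laplacian v x‖ ^ 2) ^ e)) ∧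
    (¬ IsRateBudget (d := Fin 3) (fun v => 2⁻¹ * ∫ x, ‖Torus.laplacian v x‖ ^ 2) (fun _ _ => 0)) ∧
    (∀ a b e : ℝ, b - a + 3 * e < 5 → ∀ Cν : ℝ → ℝ,
      ¬ IsRateBudget (d := Fin 3) (fun v => 2⁻¹ * ∫ x, ‖Torus.laplacian v x‖ ^ 2) (fun ν v =>
        Cν ν * Torus.kineticEnergy v ^ a * torusEnstrophy v ^ b *
          (∫ x, ‖Torus.laplacian v x‖ ^ 2) ^ e)) ∧
    PalinstrophySupRateFails (d := Fin 3) ∧ PalinstrophyRateSupFails (d := Fin 3) ∧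
    (∀ C c : ℝ, C ≤ 1 / 40 → 0 ≤ c → c ≤ 1 → ¬ PalinstrophyLogBudget (d := Fin 3) C c) :=
  ⟨not_isRateBudget_torusEnstrophy_zero, not_enstrophyQuadraticBudget,
    fun a b e h Cν => not_isRateBudget_torusEnstrophy_monomial a b e h Cν,
    not_isRateBudget_palinstrophy_zero,
    fun a b e h Cν => not_isRateBudget_palinstrophy_monomial a b e h Cν,
    LogDoor.palinstrophySupRateFails_fin3, palinstrophyRateSupFails_fin3,
    fun _C _c hC hc0 hc1 => not_palinstrophyLogBudget_of_le hC hc0 hc1⟩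

/-- **Barrier B0, positive rows (ledger v6)** — the typed doors that are PROVED open: the logged row at
large `C` (BKM shape) with the window floor `1/40 ≤ C₀(c)` on `0 < c ≤ 1`, the palinstrophy
saturating law at `κ ≥ κ_A`, and the Hölder stretching bound `2/√3` (static and dynamic).
Search for candidate a priori estimates; no regularity claim. [ours] -/
theorem barrier_positive_rows :
    PalinstrophyLogBudgetLargeC (d := Fin 3) ∧
    (∀ c : ℝ, 0 < c → c ≤ 1 → (1 : ℝ) / 40 ≤ logBudgetThreshold (d := Fin 3) c) ∧
    PalinstrophyLadderLaw (d := Fin 3) ∧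
    StretchingSupHolder (d := Fin 3) ∧ EnstrophyRateSupBound (d := Fin 3) (2 / Real.sqrt 3) :=
  ⟨palinstrophyLogBudgetLargeC_fin3_holds, fun _c hc0 hc1 => oneFortieth_le_logBudgetThreshold hc0 hc1,
    palinstrophyLadderLaw, stretchingSupHolder_holds, enstrophyRateSupBound_holder⟩

/-- **The barrier, both sides, as one declaration.** [ours] -/
theorem barrier_v6 :
    ((¬ IsRateBudget (d := Fin 3) torusEnstrophy (fun _ _ => 0)) ∧
      (∀ C : ℝ, ¬ EnstrophyQuadraticBudget (d := Fin 3) C) ∧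
      PalinstrophySupRateFails (d := Fin 3) ∧
      (∀ C c : ℝ, C ≤ 1 / 40 → 0 ≤ c → c ≤ 1 → ¬ PalinstrophyLogBudget (d := Fin 3) C c)) ∧
    (PalinstrophyLogBudgetLargeC (d := Fin 3) ∧ PalinstrophyLadderLaw (d := Fin 3) ∧
      StretchingSupHolder (d := Fin 3)) :=
  ⟨⟨barrier_negative_rows.1, barrier_negative_rows.2.1, barrier_negative_rows.2.2.2.2.2.1,
      barrier_negative_rows.2.2.2.2.2.2.2⟩,
    ⟨barrier_positive_rows.1, barrier_positive_rows.2.2.1, barrier_positive_rows.2.2.2.1⟩⟩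

end Summit.NavierStokesRegularity.FunctionalMining

end
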